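import Summits.CriticalPhenomena.PercolationContinuityZ3.Theorems.PercNearOneGluingNoHeavyQuantGatedSliceMixLawQRoutingDeep
import Summits.CriticalPhenomena.PercolationContinuityZ3.Theorems.PercNearOneGluingNoHeavyQuantGatedSliceMixLawC2
import Summits.CriticalPhenomena.PercolationContinuityZ3.Theorems.PercNearOneGluingNoHeavyQuantLightTwoBlobFlow
import HarnessLib

/-!
# QUANT lane R8, T-DEC, leg (III), blob case — `LawDec.GatedSliceMixLaw'`, cell A5 (unsaturated mid): the FILLING ROUTING of the moved law
# (`ℓ → k₂` entirely, `k₂` filled up with `k₁`, the rest of `k₁` and the zero on the giant) reduced to ONE scalar inequality, and that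
# inequality PROVED when the pair `(k₁, k₂)` is heavy and either the shifted low `ℓ = k₁ + a` is heavy at `k₂` too or
# `2k₁(k₂ − S) ≤ t(t − S − k₁)`

builds on p205010 (kernel theorem, internal audit signed; external expert review pending)

Support file (`--supports stmt-CriticalPhenomena-4575`), QUANT lane lead seat prim-quant-lead (gen 33), rung R8 of
`run/shared/lean/prim/quant/LADDER.md`.  Lead g33 NOTES (§ cell A5) and typer g30 `…/MIXLAW-MIXTURES-G30.md` §8 (ii′).  Theorems only,
standard axioms, no sorries.  Tools: arm-1 g41's routing theorem `mixLawQ_decAtT_of_routing_deep`, `usage_mul_sub_le` (typer g30), the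
closed form `usage_eq_heavy'`.

THE SUB-CELL (ii′) OF A5 (heavy pair `y(k₂−k₁) ≤ t − 2k₁` and `k₁ < ag(1−z)`; `k₂` can absorb all of `ℓ` but not both lows): the moved law
`P = zδ₀ + m₁δ_{k₁} + m₁′δ_ℓ + m₂δ_{k₂} + m₂′δ_{k₂+a}` is DEC BY ITSELF in every instance (lead g33 exact census, 200 000 / 0), certified by the
filling routing (`decAtT_movedTwoPoint_of_fill`: `x = (m₂ − usage(ℓ,k₂)m₁′)/usage(k₁,k₂)` of `k₁` into `k₂`) whose only condition is
(OFF) `y·(z + m₁ − x) ≤ (1 − y)·m₂′`.  With the heavy closed form `usage(k₁,k₂) = (t−2k₁)/(k₂+k₁−t)` and the mean identity, (OFF) follows from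
`t ≤ 2S/(1−z)` (always) and the LOAD BOUND (LB) `t(k₂+k₁−t)·usage(ℓ,k₂) ≤ (t−ℓ)(t−2k₁)` (`movedTwoPoint_off_of_loadBound`); (LB) holds when
`ℓ` is heavy at `k₂` (`loadBound_of_heavyShift`, needs `k₁ ≤ a`) and when `2k₁(k₂−S) ≤ t(t−S−k₁)` (`loadBound_of_smallBracket`, by
`usage_mul_sub_le`).  The remaining corner (`ℓ` light at `k₂`, `2k₁(k₂−S) > t(t−S−k₁)`) is the typed residual cell `MixLawCellA5r`
(census 65 000 / 0; (LB) itself holds there too, within 0.7 % of equality, by unsaturation + the three floors bounds — not yet kernel).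

* `LawDec.decAtT_movedTwoPoint_of_fill` — the filling routing under (OFF).
* `LawDec.movedTwoPoint_off_of_loadBound` — (LB) ∧ heavy pair ⟹ (OFF).
* `LawDec.loadBound_of_heavyShift`, `LawDec.loadBound_of_smallBracket` — the two proved cases of (LB).

[this work]; routing theorem: arm-1 g41; plan: typer g30.  The gluing rows served [cite: KozmaNitzan2024, Conjecture 3 (p. 15)]; product
measure [cite: Grimmett1999, §1.3 p. 10].
-/

noncomputable section

namespace Summit.CriticalPhenomena.PercolationContinuityZ3.Theorems

namespace Quant

open Finset

/-- the two-point law `{lo, hi; g}` (as in `…QuantLawDEC`) -/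
local notation3 "TP[" lo ", " hi ", " g ", " h "]" =>
  (g : ℝ) * (if (h : ℕ) = (hi : ℕ) then (1 : ℝ) else 0) + (1 - (g : ℝ)) * (if (h : ℕ) = (lo : ℕ) then (1 : ℝ) else 0)

namespace LawDec

/-! ### The filling routing -/

set_option maxHeartbeats 800000 in
/-- **the filling routing**: frame of cell A5 without `h` (`1 ≤ k₁`, `2(k₁+a) < t`, `k₁+a ≤ j`; `2k₂ ≥ t`, `t < k₁ + k₂`; `k₂+a ≥ j+1`),
unsaturated (`usage(ℓ,k₂)m₁′ ≤ m₂`), not both fitting (`m₂ ≤ usage(ℓ,k₂)m₁′ + usage(k₁,k₂)m₁`), and the offer inequality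
(OFF) `y(z + m₁ − (m₂ − usage(ℓ,k₂)m₁′)/usage(k₁,k₂)) ≤ (1−y)m₂′` ⟹ the moved law is DEC. [this work] -/
theorem decAtT_movedTwoPoint_of_fill (y z g S lam : ℝ) (a j M k₁ k₂ : ℕ)
    (hy0 : 0 < y) (hy1 : y < 1) (hz0 : 0 ≤ z) (hz1 : z < 1) (hg1 : g ≤ 1) (hyg : y ≤ (1 - z) * g) (ha : 1 ≤ a)
    (hta : y * (M : ℝ) ≤ S) (hk : k₁ ≤ k₂) (hk₂M : k₂ ≤ M) (hlam0 : 0 ≤ lam) (hlam1 : lam ≤ 1)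
    (hmean : (1 - z) * ((k₁ : ℝ) + ((k₂ : ℝ) - k₁) * lam) = S)
    (hk₁ : 1 ≤ k₁) (hllow : 2 * ((k₁ + a : ℕ) : ℝ) < S + (a : ℝ) * g * (1 - z)) (hlj : k₁ + a ≤ j)
    (hk₂mid : S + (a : ℝ) * g * (1 - z) ≤ 2 * (k₂ : ℝ)) (hcomp₁ : S + (a : ℝ) * g * (1 - z) < (k₁ : ℝ) + k₂)
    (hk₂aG : j + 1 ≤ k₂ + a)
    (hunsat : usage y (S + (a : ℝ) * g * (1 - z)) j (k₁ + a) k₂ * ((1 - z) * (1 - lam) * g) ≤ (1 - z) * lam * (1 - g))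
    (hfull : (1 - z) * lam * (1 - g) ≤ usage y (S + (a : ℝ) * g * (1 - z)) j (k₁ + a) k₂ * ((1 - z) * (1 - lam) * g)
      + usage y (S + (a : ℝ) * g * (1 - z)) j k₁ k₂ * ((1 - z) * (1 - lam) * (1 - g)))
    (hoff : y * (z + (1 - z) * (1 - lam) * (1 - g)
        - ((1 - z) * lam * (1 - g) - usage y (S + (a : ℝ) * g * (1 - z)) j (k₁ + a) k₂ * ((1 - z) * (1 - lam) * g))
          / usage y (S + (a : ℝ) * g * (1 - z)) j k₁ k₂) ≤ (1 - y) * ((1 - z) * lam * g)) :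
    DECAtT y (S + (a : ℝ) * g * (1 - z)) j (M + a)
      (fun p => z * (if p = 0 then (1 : ℝ) else 0) + (1 - z) * slice (fun q => TP[k₁, k₂, lam, q]) a g p) := by
  classical
  set t : ℝ := S + (a : ℝ) * g * (1 - z) with ht
  have h1z : 0 < 1 - z := by linarith
  have hg0 : 0 < g := by nlinarith
  have h1y : 0 < 1 - y := by linarith
  have ha0 : (0 : ℝ) ≤ a := Nat.cast_nonneg a
  have h1lam : 0 ≤ 1 - lam := by linarith
  set A : ℝ := (1 - z) * (1 - lam) * (1 - g) with hA
  set B : ℝ := (1 - z) * (1 - lam) * g with hB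
  set C : ℝ := (1 - z) * lam * (1 - g) with hC
  set D : ℝ := (1 - z) * lam * g with hD
  have hA0 : 0 ≤ A := mul_nonneg (mul_nonneg h1z.le h1lam) (by linarith)
  have hB0 : 0 ≤ B := mul_nonneg (mul_nonneg h1z.le h1lam) hg0.le
  have hD0 : 0 ≤ D := mul_nonneg (mul_nonneg h1z.le hlam0) hg0.le
  have ht0 : 0 < t := by
    have : (0 : ℝ) ≤ ((k₁ + a : ℕ) : ℝ) := Nat.cast_nonneg _
    linarith
  have hk1low : 2 * (k₁ : ℝ) < t := by push_cast at hllow; linarith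
  have hcompl : t < ((k₁ + a : ℕ) : ℝ) + k₂ := by push_cast at hcomp₁ ⊢; linarith
  set Ul : ℝ := usage y t j (k₁ + a) k₂ with hUl
  set U₁ : ℝ := usage y t j k₁ k₂ with hU₁
  have hlk₂ : k₁ + a < k₂ := by
    have : ((k₁ + a : ℕ) : ℝ) < k₂ := by push_cast at hllow hcompl ⊢; linarith
    exact_mod_cast this
  have hk₁k₂ : k₁ < k₂ := by omega
  have hU₁pos : 0 < U₁ := usage_pos_of_compat y t j k₁ k₂ hy0 hy1 hk1low hk₁k₂ (Or.inr hcomp₁)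
  set cap : ℝ := C - Ul * B with hcap
  have hcap0 : 0 ≤ cap := by rw [hcap, hUl]; linarith [hunsat]
  set x : ℝ := cap / U₁ with hx
  have hx0 : 0 ≤ x := div_nonneg hcap0 hU₁pos.le
  have hxU : U₁ * x = cap := by rw [hx]; field_simp
  have hxA : x ≤ A := by
    rw [hx, div_le_iff₀ hU₁pos, hcap]
    have : C ≤ Ul * B + U₁ * A := by rw [hUl, hU₁]; exact hfull
    linarith
  have hoff' : y * (z + A - x) ≤ (1 - y) * D := by rw [hx, hcap, hUl, hU₁]; exact hoff
  have hu : usage y t j k₁ (k₂ + a) = y / (1 - y) := usage_giant_eq y t j k₁ (k₂ + a) hk₂aG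
  have hul : usage y t j (k₁ + a) (k₂ + a) = y / (1 - y) := usage_giant_eq y t j (k₁ + a) (k₂ + a) hk₂aG
  have hk₁j : k₁ ≤ j := by omega
  refine mixLawQ_decAtT_of_routing_deep y z g S lam a j M k₁ k₂ x (A - x) B 0 hy0 hy1 hz0 hz1 hg1 hyg ha hta hk hk₂M hlam0 hlam1
    hmean hk₁ hlj hllow (Or.inl hk₂mid) hk₂aG hx0 (by linarith) hB0 le_rfl (by simp only [hA]; ring) (by simp only [hB]; ring)
    (fun _ => Or.inr hcomp₁) (fun _ => Or.inr hcompl) ?_ ?_ ?_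
  · -- capacity of the mid k₂: exactly full
    rw [← ht, ← hU₁, ← hUl, hxU, hcap]; simp only [hC]; linarith
  · -- capacity of the giant
    rw [← ht, hu, hul, mul_zero, add_zero, div_mul_eq_mul_div, div_le_iff₀ h1y]
    simp only [hD] at hoff'
    nlinarith [mul_nonneg hy0.le hz0]
  · -- the offer inequality (the leftover of k₂ is zero)
    rw [← ht, hu, hul, ← hU₁, ← hUl, hxU, mul_zero, add_zero]
    have e0 : (1 - z) * lam * (1 - g) - (cap + Ul * B) = 0 := by rw [hcap]; simp only [hC]; ring
    rw [e0, mul_zero, zero_add]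
    have e : t * (1 - y) / y * ((1 - z) * lam * g - y / (1 - y) * (A - x)) = t * ((1 - y) / y * D - (A - x)) := by
      simp only [hD]; field_simp
    rw [e]
    refine mul_le_mul_of_nonneg_left ?_ ht0.le
    rw [le_sub_iff_add_le, div_mul_eq_mul_div, le_div_iff₀ hy0]
    nlinarith [hoff']

/-! ### (OFF) from the load bound (LB) for a heavy pair -/

set_option maxHeartbeats 800000 in
/-- **(LB) ∧ heavy pair ⟹ (OFF).**  Frame numerics: `0 < y < 1`, `0 ≤ z < 1`, `0 < g ≤ 1`, `0 ≤ λ ≤ 1`, `1 ≤ a`, the mean identity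
`(1−z)(k₁ + (k₂−k₁)λ) = S`, `2(k₁+a) < t`, `t < k₁ + k₂`, `k₂ ≤ j`, `y(k₂ + a) ≤ t`; the pair `(k₁,k₂)` HEAVY (`y(k₂−k₁) ≤ t−2k₁`); and
(LB) `t(k₂+k₁−t)·usage(ℓ,k₂) ≤ (t−ℓ)(t−2k₁)`.  Proof: mean identity, `usage(k₁,k₂) = (t−2k₁)/(k₂+k₁−t)`, `t ≤ 2S/(1−z)`. [this work] -/
theorem movedTwoPoint_off_of_loadBound (y z g S lam : ℝ) (a j k₁ k₂ : ℕ)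
    (hy0 : 0 < y) (hy1 : y < 1) (hz0 : 0 ≤ z) (hz1 : z < 1) (hg0 : 0 < g) (hg1 : g ≤ 1) (ha : 1 ≤ a)
    (hlam0 : 0 ≤ lam) (hlam1 : lam ≤ 1) (hmean : (1 - z) * ((k₁ : ℝ) + ((k₂ : ℝ) - k₁) * lam) = S)
    (hllow : 2 * ((k₁ + a : ℕ) : ℝ) < S + (a : ℝ) * g * (1 - z)) (hcomp₁ : S + (a : ℝ) * g * (1 - z) < (k₁ : ℝ) + k₂) (hk₂j : k₂ ≤ j)
    (htaG : y * ((k₂ : ℝ) + a) ≤ S + (a : ℝ) * g * (1 - z))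
    (hheavy : y * ((k₂ : ℝ) - k₁) ≤ S + (a : ℝ) * g * (1 - z) - 2 * (k₁ : ℝ))
    (hLB : (S + (a : ℝ) * g * (1 - z)) * ((k₂ : ℝ) + k₁ - (S + (a : ℝ) * g * (1 - z)))
        * usage y (S + (a : ℝ) * g * (1 - z)) j (k₁ + a) k₂
      ≤ (S + (a : ℝ) * g * (1 - z) - ((k₁ + a : ℕ) : ℝ)) * (S + (a : ℝ) * g * (1 - z) - 2 * (k₁ : ℝ))) :
    y * (z + (1 - z) * (1 - lam) * (1 - g)
        - ((1 - z) * lam * (1 - g) - usage y (S + (a : ℝ) * g * (1 - z)) j (k₁ + a) k₂ * ((1 - z) * (1 - lam) * g))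
          / usage y (S + (a : ℝ) * g * (1 - z)) j k₁ k₂) ≤ (1 - y) * ((1 - z) * lam * g) := by
  set t : ℝ := S + (a : ℝ) * g * (1 - z) with ht
  have h1z : 0 < 1 - z := by linarith
  have h1y : 0 < 1 - y := by linarith
  have ha0 : (1 : ℝ) ≤ a := by exact_mod_cast ha
  have hk₁0 : (0 : ℝ) ≤ k₁ := Nat.cast_nonneg k₁
  have h1lam : 0 ≤ 1 - lam := by linarith
  set A : ℝ := (1 - z) * (1 - lam) * (1 - g) with hA
  set B : ℝ := (1 - z) * (1 - lam) * g with hB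
  set C : ℝ := (1 - z) * lam * (1 - g) with hC
  set D : ℝ := (1 - z) * lam * g with hD
  have hB0 : 0 ≤ B := mul_nonneg (mul_nonneg h1z.le h1lam) hg0.le
  have hC0 : 0 ≤ C := mul_nonneg (mul_nonneg h1z.le hlam0) (by linarith)
  have hD0 : 0 ≤ D := mul_nonneg (mul_nonneg h1z.le hlam0) hg0.le
  have hk1low : 2 * (k₁ : ℝ) < t := by push_cast at hllow; linarith
  have hlk₂' : k₁ < k₂ := by
    have : (k₁ : ℝ) < k₂ := by linarith
    exact_mod_cast this
  -- abbreviations p = t − 2k₁ > 0, q = k₂ + k₁ − t > 0, r = t − ℓ > 0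
  set p : ℝ := t - 2 * (k₁ : ℝ) with hp
  set q : ℝ := (k₂ : ℝ) + k₁ - t with hq
  set r : ℝ := t - ((k₁ + a : ℕ) : ℝ) with hr
  have hp0 : 0 < p := by rw [hp]; linarith
  have hq0 : 0 < q := by rw [hq]; linarith
  have ht0 : 0 < t := by linarith
  -- the heavy closed form of usage(k₁,k₂)
  have hU₁ : usage y t j k₁ k₂ = p / q := by
    rw [usage_eq_heavy' y t j k₁ k₂ hy0 hy1 hk₂j hk1low hcomp₁ hheavy, hp, hq]; ring_nf
  set Ul : ℝ := usage y t j (k₁ + a) k₂ with hUl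
  have hcompl : t < ((k₁ + a : ℕ) : ℝ) + k₂ := by push_cast at hcomp₁ ⊢; linarith
  have hlk₂ : k₁ + a < k₂ := by
    have : ((k₁ + a : ℕ) : ℝ) < k₂ := by push_cast at hllow hcompl ⊢; linarith
    exact_mod_cast this
  have hUl0 : 0 ≤ Ul := (usage_pos_of_compat y t j (k₁ + a) k₂ hy0 hy1 hllow hlk₂ (Or.inr hcompl)).le
  -- the mean identity
  have hmeanid : t * z = -((t - k₁) * A) - r * B + ((k₂ : ℝ) - t) * C + ((k₂ : ℝ) + a - t) * D := by
    simp only [hA, hB, hC, hD, hr]; push_cast; rw [ht]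
    have hS' : S = (1 - z) * ((k₁ : ℝ) + ((k₂ : ℝ) - k₁) * lam) := hmean.symm
    rw [hS']; ring
  -- T7: p·A ≤ (p + 2q)·C  ⟸  t ≤ 2Ŝ (α ≤ S)
  have hT7 : p * A ≤ (p + 2 * q) * C := by
    have e1 : (p + 2 * q) * C - p * A = (1 - z) * (1 - g) * (2 * ((k₁ : ℝ) + ((k₂ : ℝ) - k₁) * lam) - t) := by
      simp only [hA, hC, hp, hq]; ring
    have hSa : (a : ℝ) * g * (1 - z) ≤ S := by
      -- 2ℓ < t = S + ag(1−z) and ℓ ≥ a ≥ ag(1−z)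
      have hgz : g * (1 - z) ≤ 1 := by nlinarith
      have h6 : (a : ℝ) * g * (1 - z) ≤ a := by
        have := mul_le_mul_of_nonneg_left hgz (by linarith : (0:ℝ) ≤ a)
        linarith [show (a : ℝ) * g * (1 - z) = a * (g * (1 - z)) by ring]
      push_cast at hllow; rw [ht] at hllow; linarith
    have h2 : t ≤ 2 * ((k₁ : ℝ) + ((k₂ : ℝ) - k₁) * lam) := by
      have h3 : S ≤ (k₁ : ℝ) + ((k₂ : ℝ) - k₁) * lam := by
        have h4 : 0 ≤ (k₁ : ℝ) + ((k₂ : ℝ) - k₁) * lam := by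
          have : (k₁ : ℝ) ≤ k₂ := by exact_mod_cast hlk₂'.le
          nlinarith
        have e6 : S = ((k₁ : ℝ) + ((k₂ : ℝ) - k₁) * lam) - z * ((k₁ : ℝ) + ((k₂ : ℝ) - k₁) * lam) := by rw [← hmean]; ring
        rw [e6]; linarith [mul_nonneg hz0 h4]
      rw [ht]; linarith
    have : 0 ≤ (1 - z) * (1 - g) * (2 * ((k₁ : ℝ) + ((k₂ : ℝ) - k₁) * lam) - t) :=
      mul_nonneg (mul_nonneg h1z.le (by linarith)) (by linarith)
    linarith [e1]
  -- rewrite (OFF) with U₁ = p/q and clear denominators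
  rw [hU₁]
  have hpq : p / q ≠ 0 := (div_pos hp0 hq0).ne'
  have e2 : (C - Ul * B) / (p / q) = q * (C - Ul * B) / p := by field_simp
  rw [e2]
  -- target: y (z + A − q(C − Ul B)/p) ≤ (1 − y) D ; multiply by t·p > 0
  have key : y * (t * (p * (z + A) - q * (C - Ul * B))) ≤ (1 - y) * D * (t * p) := by
    have e3 : t * (p * (z + A) - q * (C - Ul * B))
        = p * ((k₁ : ℝ) * A) - p * r * B + t * q * Ul * B + (p * ((k₂ : ℝ) - t) - t * q) * C + p * (((k₂ : ℝ) + a - t) * D) := by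
      have : t * z = -((t - k₁) * A) - r * B + ((k₂ : ℝ) - t) * C + ((k₂ : ℝ) + a - t) * D := hmeanid
      linear_combination p * this
    have e4 : p * ((k₂ : ℝ) - t) - t * q = -((k₁ : ℝ) * (p + 2 * q)) := by simp only [hp, hq]; ring
    rw [e3, e4]
    -- the k₁-terms: p k₁ A − k₁(p+2q) C ≤ 0 (T7); the B-terms: t q Ul B ≤ p r B (LB); the D-term: y p (k₂+a−t) D ≤ (1−y) D t p (TA)
    have i1 : p * ((k₁ : ℝ) * A) + -((k₁ : ℝ) * (p + 2 * q)) * C ≤ 0 := by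
      have h7 := mul_le_mul_of_nonneg_left hT7 hk₁0
      have e7 : p * ((k₁ : ℝ) * A) + -((k₁ : ℝ) * (p + 2 * q)) * C = (k₁ : ℝ) * (p * A) - (k₁ : ℝ) * ((p + 2 * q) * C) := by ring
      rw [e7]; linarith
    have i2 : t * q * Ul * B ≤ p * r * B := by
      have hLB' : t * q * Ul ≤ r * p := by rw [hq, hr, hp, hUl]; exact hLB
      have h8 := mul_le_mul_of_nonneg_right hLB' hB0
      linarith [show r * p * B = p * r * B by ring]
    have i3 : y * (p * (((k₂ : ℝ) + a - t) * D)) ≤ (1 - y) * D * (t * p) := by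
      have h5 : y * ((k₂ : ℝ) + a - t) ≤ (1 - y) * t := by
        have e8 : y * ((k₂ : ℝ) + a - t) = y * ((k₂ : ℝ) + a) - y * t := by ring
        rw [e8]; nlinarith
      have h9 := mul_le_mul_of_nonneg_left h5 (mul_nonneg hp0.le hD0)
      have e9 : y * (p * (((k₂ : ℝ) + a - t) * D)) = p * D * (y * ((k₂ : ℝ) + a - t)) := by ring
      have e10 : (1 - y) * D * (t * p) = p * D * ((1 - y) * t) := by ring
      rw [e9, e10]; exact h9
    have hsum : p * ((k₁ : ℝ) * A) - p * r * B + t * q * Ul * B + -((k₁ : ℝ) * (p + 2 * q)) * C ≤ 0 := by linarith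
    have h10 := mul_le_mul_of_nonneg_left hsum hy0.le
    rw [mul_zero] at h10
    have e11 : y * (p * ((k₁ : ℝ) * A) - p * r * B + t * q * Ul * B + -((k₁ : ℝ) * (p + 2 * q)) * C + p * (((k₂ : ℝ) + a - t) * D))
        = y * (p * ((k₁ : ℝ) * A) - p * r * B + t * q * Ul * B + -((k₁ : ℝ) * (p + 2 * q)) * C) + y * (p * (((k₂ : ℝ) + a - t) * D)) := by
      ring
    rw [e11]; linarith
  have htp : 0 < t * p := mul_pos ht0 hp0
  have e5 : y * (z + A - q * (C - Ul * B) / p) = y * (t * (p * (z + A) - q * (C - Ul * B))) / (t * p) := by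
    field_simp
  rw [e5, div_le_iff₀ htp]
  exact key

/-! ### The two proved cases of the load bound (LB) -/

/-- **(LB) when the shifted low is HEAVY at `k₂`** (`y(k₂ − ℓ) ≤ t − 2ℓ`) and `k₁ ≤ a`: then `usage(ℓ,k₂) = (t−2ℓ)/(k₂+ℓ−t)` and
`t(t − 2ℓ) ≤ (t − ℓ)(t − 2k₁)` because the difference is `t(a − k₁) + 2k₁ℓ ≥ 0`. [this work] -/
theorem loadBound_of_heavyShift (y t : ℝ) (a j k₁ k₂ : ℕ) (hy0 : 0 < y) (hy1 : y < 1) (hk₁a : k₁ ≤ a)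
    (hllow : 2 * ((k₁ + a : ℕ) : ℝ) < t) (hcomp₁ : t < (k₁ : ℝ) + k₂) (hk₂j : k₂ ≤ j)
    (hheavyl : y * ((k₂ : ℝ) - ((k₁ + a : ℕ) : ℝ)) ≤ t - 2 * ((k₁ + a : ℕ) : ℝ)) :
    t * ((k₂ : ℝ) + k₁ - t) * usage y t j (k₁ + a) k₂ ≤ (t - ((k₁ + a : ℕ) : ℝ)) * (t - 2 * (k₁ : ℝ)) := by
  have hk₁0 : (0 : ℝ) ≤ k₁ := Nat.cast_nonneg k₁
  have hcompl : t < ((k₁ + a : ℕ) : ℝ) + k₂ := by push_cast at hcomp₁ ⊢; linarith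
  rw [usage_eq_heavy' y t j (k₁ + a) k₂ hy0 hy1 hk₂j hllow hcompl hheavyl]
  have hden : 0 < ((k₁ + a : ℕ) : ℝ) + k₂ - t := by linarith
  rw [mul_div_assoc', div_le_iff₀ hden]
  have hq0 : 0 < (k₂ : ℝ) + k₁ - t := by linarith
  have hqq : (k₂ : ℝ) + k₁ - t ≤ ((k₁ + a : ℕ) : ℝ) + k₂ - t := by push_cast; linarith
  have ht0 : 0 < t := by have : (0:ℝ) ≤ ((k₁ + a : ℕ) : ℝ) := Nat.cast_nonneg _; linarith
  have hnum : t * (t - 2 * ((k₁ + a : ℕ) : ℝ)) ≤ (t - ((k₁ + a : ℕ) : ℝ)) * (t - 2 * (k₁ : ℝ)) := by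
    have hka : (k₁ : ℝ) ≤ a := by exact_mod_cast hk₁a
    push_cast; nlinarith
  have h1 : 0 ≤ t - 2 * ((k₁ + a : ℕ) : ℝ) := by linarith
  have h2 : 0 ≤ (t - ((k₁ + a : ℕ) : ℝ)) * (t - 2 * (k₁ : ℝ)) := by
    apply mul_nonneg <;> [skip; skip] <;> push_cast at hllow ⊢ <;> nlinarith
  calc t * ((k₂ : ℝ) + k₁ - t) * (t - 2 * ((k₁ + a : ℕ) : ℝ))
      = (t * (t - 2 * ((k₁ + a : ℕ) : ℝ))) * ((k₂ : ℝ) + k₁ - t) := by ring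
    _ ≤ ((t - ((k₁ + a : ℕ) : ℝ)) * (t - 2 * (k₁ : ℝ))) * ((k₂ : ℝ) + k₁ - t) := mul_le_mul_of_nonneg_right hnum hq0.le
    _ ≤ ((t - ((k₁ + a : ℕ) : ℝ)) * (t - 2 * (k₁ : ℝ))) * (((k₁ + a : ℕ) : ℝ) + k₂ - t) := mul_le_mul_of_nonneg_left hqq h2

/-- **(LB) when `2k₁(k₂ − S) ≤ t(t − S − k₁)`** (frame: `2ℓ < t`, `t < ℓ + k₂`, `k₂ ≤ j`, `y·k₂ ≤ S ≤ t`, `t − S ≤ ℓ`): by the usage bound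
`usage(ℓ,k₂)(k₂ − S) ≤ t − ℓ` (`usage_mul_sub_le`), since then `t(k₂+k₁−t) ≤ (t−2k₁)(k₂−S)`. [this work] -/
theorem loadBound_of_smallBracket (y t S : ℝ) (a j k₁ k₂ : ℕ) (hy0 : 0 < y) (hy1 : y < 1)
    (hllow : 2 * ((k₁ + a : ℕ) : ℝ) < t) (hcompl : t < ((k₁ + a : ℕ) : ℝ) + k₂) (hk₂j : k₂ ≤ j)
    (hyk₂ : y * (k₂ : ℝ) ≤ S) (hSk₂ : S < (k₂ : ℝ)) (hSt : S ≤ t) (htSl : t - S ≤ ((k₁ + a : ℕ) : ℝ))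
    (hbr : 2 * (k₁ : ℝ) * ((k₂ : ℝ) - S) ≤ t * (t - S - (k₁ : ℝ))) :
    t * ((k₂ : ℝ) + k₁ - t) * usage y t j (k₁ + a) k₂ ≤ (t - ((k₁ + a : ℕ) : ℝ)) * (t - 2 * (k₁ : ℝ)) := by
  have hU := usage_mul_sub_le y t S j (k₁ + a) k₂ hy0 hy1 hllow hk₂j hcompl hyk₂ hSt htSl
  have hs : 0 < (k₂ : ℝ) - S := by linarith
  have hlk₂ : k₁ + a < k₂ := by
    have : ((k₁ + a : ℕ) : ℝ) < k₂ := by linarith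
    exact_mod_cast this
  have hUl0 : 0 ≤ usage y t j (k₁ + a) k₂ := (usage_pos_of_compat y t j (k₁ + a) k₂ hy0 hy1 hllow hlk₂ (Or.inr hcompl)).le
  have ht0 : 0 ≤ t := by have : (0:ℝ) ≤ ((k₁ + a : ℕ) : ℝ) := Nat.cast_nonneg _; linarith
  -- t·q ≤ (t − 2k₁)(k₂ − S)
  have htq : t * ((k₂ : ℝ) + k₁ - t) ≤ (t - 2 * (k₁ : ℝ)) * ((k₂ : ℝ) - S) := by nlinarith
  have hr0 : 0 ≤ t - ((k₁ + a : ℕ) : ℝ) := by linarith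
  calc t * ((k₂ : ℝ) + k₁ - t) * usage y t j (k₁ + a) k₂
      ≤ (t - 2 * (k₁ : ℝ)) * ((k₂ : ℝ) - S) * usage y t j (k₁ + a) k₂ := mul_le_mul_of_nonneg_right htq hUl0
    _ = (t - 2 * (k₁ : ℝ)) * (usage y t j (k₁ + a) k₂ * ((k₂ : ℝ) - S)) := by ring
    _ ≤ (t - 2 * (k₁ : ℝ)) * (t - ((k₁ + a : ℕ) : ℝ)) :=
        mul_le_mul_of_nonneg_left hU (by push_cast at hllow; linarith [(Nat.cast_nonneg a : (0 : ℝ) ≤ a)])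
    _ = (t - ((k₁ + a : ℕ) : ℝ)) * (t - 2 * (k₁ : ℝ)) := by ring

end LawDec

end Quant

end Summit.CriticalPhenomena.PercolationContinuityZ3.Theorems
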